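import Literature.NumberTheory.Rogawski1990.ArchEndoscopicEigenvalueCompact   -- ★ p848061: brings ★ `torusMatrix`∕`conjTranspose_torusMatrix_mul` (EndoscopicTorusRankTwo), ★ `sub_one_mul_frameGram_apply_eq_zero` (StableClassesSplitTorus), ★ `exists_conj_eq_diagonal_of_nodup_roots'` (Diagonalization), ★ `IsArchGRegular`∕`endoEmbArch`∕`charpoly_endoGL` (ArchimedeanTransfer), ★ `archPiEquivCM`∕`coe_archPiEquivCM_apply`, ★ `antidiagOne_map`
import HarnessLib

/-!
# The regular dichotomy in `U(1,1) = U(Φ₂)(ℂ)`: a regular semisimple `Φ₂`-unitary matrix is `U(Φ₂)`-conjugate to a regular point of the COMPACT torus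
# `T_c = {torusMatrix u₁ u₂}` or of the SPLIT torus `T_s = {diag(λ, λ̄⁻¹)}` (Rogawski 1990 §3.1 p. 19, §3.6 p. 31; Knapp 1986 Ch. V §3)

Topic `NumberTheory/Rogawski1990`; namespace `Literature.NumberTheory.Rogawski1990`.  THEOREMS ONLY (no `def`, no instance, no notation, no axiom, no named fact,
no `sorry`).  Cell `pub/hodgecm-mathlib`, crux H413 (`stmt-HodgeConjecture-24833`), line LH3, DEAL #21 «(DICH)» of LH3-plan (g0) (2026-09-02): the LAST missing input of
the unconditional (CONV) «Schwartz orbital integrals on `H_∞` converge at every `G`-regular class» (★ `integrable_orbitalIntegrand_of_archSchwartzGL_of_placewise_growth'`,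
LH3-p04): at each complex place the component `γ_w ∈ U(Φ₂)_w` of a `G`-regular `γ ∈ H_∞` is regular semisimple, and the per-place token `hplace w` is supplied by the
ELLIPTIC discharger (LH3-p03∕p04: `γ_w = g₀ · torusMatrix l₁ l₂ · g₀⁻¹`, `g₀ ∈ U(Φ₂)_w`, `l₁ ≠ l₂`) or by the SPLIT discharger (LH2-p04: `γ_w = h · diag(λ₁, λ₂) · h⁻¹`,
`h ∈ U(Φ₂)_w`, `λ₁ ≠ λ₂`) — THIS file proves that one of the two always applies, with the conjugator INSIDE `U(Φ₂)` (not merely in `GL₂(ℂ)`: the `GL₂`-version is the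
engine ★ `exists_isCompact_forall_isConj_of_mem_unitaryGroupOfForm_antidiag_two`, whose frame analysis is re-run here with the normalisation of the eigenframe).

MATHEMATICS (plain matrices, `Φ₂ = antidiag(1,1)`, `h(v, w) = v̄ᵀ Φ₂ w` of signature `(1,1)`).  Let `y` be `Φ₂`-unitary with distinct eigenvalues `d₀ ≠ d₁` and eigenframe
`S` (★ Horn–Johnson 1.3.9), Gram matrix `Q = S̄ᵀ Φ₂ S` (hermitian, `det Q = −|det S|² < 0`).  ★ `sub_one_mul_frameGram_apply_eq_zero`: `(d̄ᵢ dⱼ − 1) Qᵢⱼ = 0`.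
* SPLIT (`d̄₀ d₁ = 1`, then `|d₀| ≠ 1`): `Q₀₀ = Q₁₁ = 0`, `Q₀₁ ≠ 0`; the frame `V = S · diag(1, Q₀₁⁻¹)` has `V̄ᵀ Φ₂ V = Φ₂`, i.e. `V ∈ U(Φ₂)`, and `y = V diag(d₀, d₁) V⁻¹`.
* COMPACT (`d̄₀ d₁ ≠ 1`): `Q` is diagonal, `|d₀| = |d₁| = 1`, `Q₀₀ Q₁₁ < 0`; rescaling the eigenvectors to `h`-lengths `2, −2` (in the order of signs) gives a frame `V` with
  `V̄ᵀ Φ₂ V = diag(2, −2) = Pᵀ Φ₂ P`, `P = (1 1; 1 −1)`, so `g₀ = V P⁻¹ ∈ U(Φ₂)` and `y = g₀ · (P diag(d) P⁻¹) · g₀⁻¹ = g₀ · torusMatrix d₀ d₁ · g₀⁻¹` (★ `torusMatrix`).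

* §1 frame algebra: `frameGram_mul`, (private) `eq_mul_mul_inv_of_mul_eq`, `exists_unitary_conj_torusMatrix_of_frame` (the compact-torus normal form from a frame of Gram matrix `diag(2, −2)`).
* §2 **`exists_unitary_conj_torusMatrix_or_diagonal`** — the dichotomy for plain `Φ₂`-unitary matrices with separable characteristic polynomial.
* §3 the same IN THE GROUP: `exists_conj_torusMatrix_or_diagonal_of_mem_unitaryGroupOfForm` (carrier `↥(unitaryGroupOfForm (starRingEnd ℂ) Φ₂ℂ)`, LH2-p04's letters) and
  `exists_conj_torusMatrix_or_diagonal_archLocal` (carrier `↥(archLocal L 2 Φ₂ w)`, LH3's letters: first disjunct = the `hell w` binder of ★ `haar_setOf_archHSGL_conj_le_of_elliptic_linear`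
  VERBATIM, second disjunct = the `(h, γ, hγ, hne, hconj)` data of ★ `exists_measure_descConj_hs_add_one_le_rpow_of_diag_haar` up to the subgroup identification ★ `antidiagOne_map`);
  `charpoly_archPiEquivCM_separable_of_isArchGRegular` — `G`-regularity of `γ ∈ H_∞` gives the separability hypothesis at every complex place.
HONEST LABEL: HC_CM is proved only modulo the 7 printed citations (2 remaining: hLiu418 = `stmt-HodgeConjecture-24832`, h413 = `stmt-HodgeConjecture-24833`) until rung 0 closes;
count-neutral kit behind (CONV).

## References
* [Rogawski1990] J. D. Rogawski, Ann. of Math. Stud. 123 (1990), §3.1 p. 19 (conjugacy ∕ stable conjugacy in unitary groups), §3.6 p. 31 (Cartan subgroups of `U(1,1)`, `U(2,1)`),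
  §4.3 p. 42 (`G`-regular elements of `H`), §4.6 Prop. 4.6.1 (the torus `T_c`).
* [Knapp1986] A. W. Knapp, *Representation Theory of Semisimple Groups* (1986), Ch. V §3 (regular elements lie in a Cartan subgroup; conjugacy of Cartan subgroups).
* [HornJohnson2013] R. A. Horn, C. R. Johnson, *Matrix Analysis*, 2nd ed. (2013), Thm. 1.3.9 (distinct eigenvalues ⇒ diagonalisable).
-/

set_option autoImplicit false

noncomputable section

open Matrix Polynomial NumberField NumberField.InfinitePlace NumberField.mixedEmbedding
open Literature.NumberTheory.Automorphic Literature.NumberTheory.Automorphic.UnitaryGroup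
open scoped MatrixGroups ComplexConjugate

namespace Literature.NumberTheory.Rogawski1990

/-! ## §1 Frame algebra -/

section Frame

/-- Gram matrices transform by congruence: `(SW)̄ᵀ J (SW) = W̄ᵀ (S̄ᵀ J S) W`. [folklore] [cite: Rogawski1990, §3.1 p. 19] -/
theorem frameGram_mul (J S W : Matrix (Fin 2) (Fin 2) ℂ) :
    ((S * W).map (starRingEnd ℂ))ᵀ * J * (S * W) = (W.map (starRingEnd ℂ))ᵀ * ((S.map (starRingEnd ℂ))ᵀ * J * S) * W := by
  rw [Matrix.map_mul, transpose_mul]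
  simp only [Matrix.mul_assoc]

/-- `y V = V T` with `V` invertible gives `y = V T V⁻¹` (private plumbing). [folklore] -/
private theorem eq_mul_mul_inv_of_mul_eq {n : Type*} [Fintype n] [DecidableEq n] {y V T : Matrix n n ℂ} (hV : IsUnit V.det) (h : y * V = V * T) :
    y = V * T * V⁻¹ := by
  rw [← h, Matrix.mul_nonsing_inv_cancel_right _ _ hV]

/-- **The compact-torus normal form from a frame of Gram matrix `diag(2, −2)`.**  If `V` is invertible, `y V = V diag(d)` and `V̄ᵀ Φ₂ V = diag(2, −2)` (the eigenvectors are
`Φ₂`-orthogonal of `h`-lengths `2`, `−2`, as the columns of `P = (1 1; 1 −1)` are), then `g₀ = V P⁻¹` is `Φ₂`-unitary, invertible, and `y = g₀ · torusMatrix d₀ d₁ · g₀⁻¹`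
(`P diag(d) P⁻¹ = torusMatrix d₀ d₁`, ★ `torusMatrix`). [cite: Rogawski1990, §4.6 Prop. 4.6.1; §3.6 p. 31] [cite: Knapp1986, Ch. V §3] -/
theorem exists_unitary_conj_torusMatrix_of_frame {y V : Matrix (Fin 2) (Fin 2) ℂ} {d : Fin 2 → ℂ}
    (hV : (V.map (starRingEnd ℂ))ᵀ * (Matrix.of fun i j : Fin 2 => if i.val + j.val + 1 = 2 then (1 : ℂ) else 0) * V = !![2, 0; 0, -2])
    (hVdet : IsUnit V.det) (hyV : y * V = V * diagonal d) :
    ∃ g₀ : Matrix (Fin 2) (Fin 2) ℂ,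
      (g₀.map (starRingEnd ℂ))ᵀ * (Matrix.of fun i j : Fin 2 => if i.val + j.val + 1 = 2 then (1 : ℂ) else 0) * g₀ =
          (Matrix.of fun i j : Fin 2 => if i.val + j.val + 1 = 2 then (1 : ℂ) else 0) ∧
        IsUnit g₀.det ∧ y = g₀ * torusMatrix (d 0) (d 1) * g₀⁻¹ := by
  -- `Pinv = P⁻¹ = ½ P` for the frame `P = (1 1; 1 −1)`
  set Pinv : Matrix (Fin 2) (Fin 2) ℂ := !![(1 : ℂ) / 2, 1 / 2; 1 / 2, -(1 / 2)] with hPinv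
  have hPreal : Pinv.map (starRingEnd ℂ) = Pinv := by
    ext i j
    fin_cases i <;> fin_cases j <;> simp [hPinv, map_ofNat]
  have hPdet : Pinv.det = -(1 / 2) := by
    rw [hPinv, Matrix.det_fin_two]; simp; norm_num
  have hPunit : IsUnit Pinv.det := by
    rw [hPdet]; exact isUnit_iff_ne_zero.2 (by norm_num)
  refine ⟨V * Pinv, ?_, ?_, ?_⟩
  · -- unitarity: `P⁻ᵀ diag(2, −2) P⁻¹ = Φ₂`
    rw [frameGram_mul, hV, hPreal]
    ext i j
    fin_cases i <;> fin_cases j <;> simp [hPinv, Matrix.mul_apply, Fin.sum_univ_two, Matrix.of_apply] <;> norm_num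
  · rw [det_mul]
    exact hVdet.mul hPunit
  · -- `y (V P⁻¹) = (V P⁻¹) · torusMatrix d₀ d₁` because `diag(d) P⁻¹ = P⁻¹ torusMatrix d₀ d₁`
    refine eq_mul_mul_inv_of_mul_eq (by rw [det_mul]; exact hVdet.mul hPunit) ?_
    have hcomm : diagonal d * Pinv = Pinv * torusMatrix (d 0) (d 1) := by
      ext i j
      fin_cases i <;> fin_cases j <;> simp [hPinv, torusMatrix, Matrix.mul_apply, Fin.sum_univ_two, diagonal] <;> ring
    calc y * (V * Pinv) = (y * V) * Pinv := by rw [Matrix.mul_assoc]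
      _ = V * (diagonal d * Pinv) := by rw [hyV, Matrix.mul_assoc]
      _ = V * Pinv * torusMatrix (d 0) (d 1) := by rw [hcomm, Matrix.mul_assoc]

end Frame

/-! ## §2 The dichotomy for plain `Φ₂`-unitary matrices -/

section Plain

/-- **THE REGULAR DICHOTOMY IN `U(Φ₂)(ℂ) ≅ U(1,1)`, plain matrices.**  A `Φ₂`-unitary `y` (`ȳᵀ Φ₂ y = Φ₂`, `Φ₂ = antidiag(1,1)`) with separable characteristic polynomial
(two distinct eigenvalues) is conjugate BY A `Φ₂`-UNITARY `g₀` either to a regular point `torusMatrix l₁ l₂` (`l₁ ≠ l₂`) of the compact torus `T_c` (both eigenvalues of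
absolute value `1`; eigenvectors anisotropic of opposite signs) or to a regular point `diag(λ₁, λ₂)` (`λ₁ ≠ λ₂`, `λ̄₁ λ₂ = 1`) of the split torus `T_s` (eigenvalues off the
unit circle; eigenvectors isotropic): `y = g₀ T g₀⁻¹`. [cite: Rogawski1990, §3.6 p. 31; §3.1 p. 19] [cite: Knapp1986, Ch. V §3] [cite: HornJohnson2013, Thm. 1.3.9] -/
theorem exists_unitary_conj_torusMatrix_or_diagonal {y : Matrix (Fin 2) (Fin 2) ℂ}
    (hy : (y.map (starRingEnd ℂ))ᵀ * (Matrix.of fun i j : Fin 2 => if i.val + j.val + 1 = 2 then (1 : ℂ) else 0) * y =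
      (Matrix.of fun i j : Fin 2 => if i.val + j.val + 1 = 2 then (1 : ℂ) else 0))
    (hsep : y.charpoly.Separable) :
    ∃ g₀ : Matrix (Fin 2) (Fin 2) ℂ,
      (g₀.map (starRingEnd ℂ))ᵀ * (Matrix.of fun i j : Fin 2 => if i.val + j.val + 1 = 2 then (1 : ℂ) else 0) * g₀ =
          (Matrix.of fun i j : Fin 2 => if i.val + j.val + 1 = 2 then (1 : ℂ) else 0) ∧
        IsUnit g₀.det ∧
        ((∃ l₁ l₂ : ℂ, l₁ ≠ l₂ ∧ y = g₀ * torusMatrix l₁ l₂ * g₀⁻¹) ∨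
          (∃ l₁ l₂ : ℂ, l₁ ≠ l₂ ∧ starRingEnd ℂ l₁ * l₂ = 1 ∧ y = g₀ * !![l₁, 0; 0, l₂] * g₀⁻¹)) := by
  classical
  set J : Matrix (Fin 2) (Fin 2) ℂ := Matrix.of fun i j : Fin 2 => if i.val + j.val + 1 = 2 then (1 : ℂ) else 0 with hJ
  have hJ00 : J 0 0 = 0 := rfl
  have hJ01 : J 0 1 = 1 := rfl
  have hJ10 : J 1 0 = 1 := rfl
  have hJ11 : J 1 1 = 0 := rfl
  have hJdet : J.det = -1 := by rw [Matrix.det_fin_two, hJ00, hJ01, hJ10, hJ11]; ring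
  -- Step 1: an eigenframe `y S = S diag(d)`, `d₀ ≠ d₁`
  obtain ⟨S, d, hS, hSD, hd⟩ :=
    Literature.LinearAlgebra.Matrix.exists_conj_eq_diagonal_of_nodup_roots' y (Polynomial.nodup_roots hsep)
  have hd01 : d 0 ≠ d 1 := by
    intro h
    have hnd : (Finset.univ.val.map d).Nodup := by rw [hd]; exact Polynomial.nodup_roots hsep
    have := Multiset.inj_on_of_nodup_map hnd 0 (Finset.mem_univ_val 0) 1 (Finset.mem_univ_val 1) h
    exact absurd this (by decide)
  have hyS : y * S = S * diagonal d := by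
    have h := congrArg (fun M => S * M) hSD
    simpa only [← Matrix.mul_assoc, Matrix.mul_nonsing_inv _ hS, Matrix.one_mul] using h
  have hSdet : S.det ≠ 0 := hS.ne_zero
  -- Step 2: the frame Gram matrix `Q = S̄ᵀ Φ₂ S`: zero pattern, entries, determinant
  set Q : Matrix (Fin 2) (Fin 2) ℂ := (S.map (starRingEnd ℂ))ᵀ * J * S with hQ
  have hQ0 : ∀ i j, (starRingEnd ℂ (d i) * d j - 1) * Q i j = 0 := fun i j =>
    sub_one_mul_frameGram_apply_eq_zero (starRingEnd ℂ) hy hyS i j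
  have hQe : ∀ i j, Q i j = conj (S 0 i) * S 1 j + conj (S 1 i) * S 0 j := by
    intro i j
    rw [hQ, Matrix.mul_apply]
    simp only [Fin.sum_univ_two, Matrix.mul_apply, transpose_apply, Matrix.map_apply, hJ00, hJ01, hJ10, hJ11, mul_zero, mul_one,
      zero_add, add_zero]
    ring
  have hQ10 : Q 1 0 = conj (Q 0 1) := by
    rw [hQe, hQe]; simp only [map_add, map_mul, Complex.conj_conj]; ring
  have hQ00c : conj (Q 0 0) = Q 0 0 := by
    rw [hQe]; simp only [map_add, map_mul, Complex.conj_conj]; ring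
  have hQ11c : conj (Q 1 1) = Q 1 1 := by
    rw [hQe]; simp only [map_add, map_mul, Complex.conj_conj]; ring
  have hm : (S.map (starRingEnd ℂ)).det = starRingEnd ℂ S.det := by
    rw [← RingHom.mapMatrix_apply, ← RingHom.map_det]
  have hQdet : Q.det = -(conj S.det * S.det) := by
    rw [hQ, det_mul, det_mul, det_transpose, hm, hJdet]; ring
  have hQdet0 : Q.det ≠ 0 := by
    rw [hQdet]
    exact neg_ne_zero.2 (mul_ne_zero ((_root_.map_ne_zero _).2 hSdet) hSdet)
  -- the normalising frames are `V = S * W` with `W` explicit; their Gram matrix is `W̄ᵀ Q W`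
  have hgram : ∀ W : Matrix (Fin 2) (Fin 2) ℂ, ((S * W).map (starRingEnd ℂ))ᵀ * J * (S * W) = (W.map (starRingEnd ℂ))ᵀ * Q * W := fun W =>
    frameGram_mul J S W
  by_cases hsplit : starRingEnd ℂ (d 0) * d 1 = 1
  · /- SPLIT CASE: `d₁ = d̄₀⁻¹`, `|d₀| ≠ 1`, `Q₀₀ = Q₁₁ = 0`, `Q₀₁ ≠ 0`; frame `V = S diag(1, Q₀₁⁻¹)` is unitary -/
    have hd1 : d 1 ≠ 0 := fun h => by rw [h, mul_zero] at hsplit; exact zero_ne_one hsplit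
    have hd0 : d 0 ≠ 0 := fun h => by rw [h, map_zero, zero_mul] at hsplit; exact zero_ne_one hsplit
    have h00 : starRingEnd ℂ (d 0) * d 0 - 1 ≠ 0 := by
      intro h
      apply hd01
      have h1 : starRingEnd ℂ (d 0) * d 0 = starRingEnd ℂ (d 0) * d 1 := by rw [sub_eq_zero.1 h, hsplit]
      exact mul_left_cancel₀ ((_root_.map_ne_zero _).2 hd0) h1
    have h11 : starRingEnd ℂ (d 1) * d 1 - 1 ≠ 0 := by
      intro h
      apply hd01
      have h1 : starRingEnd ℂ (d 0) * d 1 = starRingEnd ℂ (d 1) * d 1 := by rw [hsplit, sub_eq_zero.1 h]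
      have h2 := mul_right_cancel₀ hd1 h1
      have h3 := congrArg (starRingEnd ℂ) h2
      simpa only [Complex.conj_conj] using h3
    have hQ00 : Q 0 0 = 0 := (mul_eq_zero.1 (hQ0 0 0)).resolve_left h00
    have hQ11 : Q 1 1 = 0 := (mul_eq_zero.1 (hQ0 1 1)).resolve_left h11
    have hQ01 : Q 0 1 ≠ 0 := by
      intro h
      apply hQdet0
      rw [Matrix.det_fin_two, hQ00, hQ11, hQ10, h, map_zero]; ring
    set W : Matrix (Fin 2) (Fin 2) ℂ := !![1, 0; 0, (Q 0 1)⁻¹] with hW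
    have hWdet : IsUnit W.det := by
      rw [hW, Matrix.det_fin_two]
      refine isUnit_iff_ne_zero.2 ?_
      simp [hQ01]
    have hVdet : IsUnit (S * W).det := by rw [det_mul]; exact hS.mul hWdet
    -- `V = S W` is `Φ₂`-unitary
    have hV : ((S * W).map (starRingEnd ℂ))ᵀ * J * (S * W) = J := by
      rw [hgram W]
      ext i j
      fin_cases i <;> fin_cases j <;>
        simp [hW, Matrix.mul_apply, Fin.sum_univ_two, hQ00, hQ11, hQ10, hJ00, hJ01, hJ10, hJ11]
      · -- entry (0,1): `Q₀₁ · Q₀₁⁻¹ = 1`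
        exact mul_inv_cancel₀ hQ01
      · -- entry (1,0): `conj(Q₀₁)⁻¹ · conj(Q₀₁) = 1`
        exact inv_mul_cancel₀ ((_root_.map_ne_zero (starRingEnd ℂ)).2 hQ01)
    -- `y V = V diag(d)`
    have hyV : y * (S * W) = (S * W) * diagonal d := by
      have hcomm : diagonal d * W = W * diagonal d := by
        ext i j
        fin_cases i <;> fin_cases j <;> simp [hW, Matrix.mul_apply, diagonal, mul_comm]
      calc y * (S * W) = (y * S) * W := by rw [Matrix.mul_assoc]
        _ = S * (diagonal d * W) := by rw [hyS, Matrix.mul_assoc]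
        _ = S * W * diagonal d := by rw [hcomm, Matrix.mul_assoc]
    have hdiag : diagonal d = !![d 0, 0; 0, d 1] := by
      ext i j; fin_cases i <;> fin_cases j <;> simp [diagonal]
    refine ⟨S * W, hV, hVdet, Or.inr ⟨d 0, d 1, hd01, hsplit, ?_⟩⟩
    rw [← hdiag]
    exact eq_mul_mul_inv_of_mul_eq hVdet hyV
  · /- COMPACT CASE: `Q` diagonal, `|d₀| = |d₁| = 1`, `Q₀₀ Q₁₁ = det Q < 0`; rescale the eigenvectors to `h`-lengths `(2, −2)` -/
    have hsplit' : starRingEnd ℂ (d 1) * d 0 - 1 ≠ 0 := by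
      intro h
      apply hsplit
      have h' := congrArg (starRingEnd ℂ) (sub_eq_zero.1 h)
      rwa [map_mul, Complex.conj_conj, map_one, mul_comm] at h'
    have hQ01 : Q 0 1 = 0 := (mul_eq_zero.1 (hQ0 0 1)).resolve_left (sub_ne_zero.2 hsplit)
    have hQ10z : Q 1 0 = 0 := (mul_eq_zero.1 (hQ0 1 0)).resolve_left hsplit'
    -- real diagonal entries `q₀ = Q₀₀`, `q₁ = Q₁₁` with `q₀ q₁ < 0`
    set q₀ : ℝ := (Q 0 0).re with hq₀
    set q₁ : ℝ := (Q 1 1).re with hq₁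
    have hQ00r : Q 0 0 = (q₀ : ℂ) := by
      rw [hq₀]; exact (Complex.conj_eq_iff_re.1 hQ00c).symm ▸ rfl
    have hQ11r : Q 1 1 = (q₁ : ℂ) := by
      rw [hq₁]; exact (Complex.conj_eq_iff_re.1 hQ11c).symm ▸ rfl
    have hprod : q₀ * q₁ = -Complex.normSq S.det := by
      have h1 : Q.det = (q₀ : ℂ) * (q₁ : ℂ) := by
        rw [Matrix.det_fin_two, hQ01, hQ10z, hQ00r, hQ11r]; ring
      have h2 : ((q₀ * q₁ : ℝ) : ℂ) = ((-Complex.normSq S.det : ℝ) : ℂ) := by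
        push_cast
        rw [← h1, hQdet, Complex.normSq_eq_conj_mul_self]
      exact_mod_cast h2
    have hneg : q₀ * q₁ < 0 := by
      rw [hprod, neg_lt_zero]
      exact Complex.normSq_pos.2 hSdet
    by_cases hpos : 0 < q₀
    · /- sub-case `Q₀₀ > 0 > Q₁₁`: frame `V = S diag(c₀, c₁)`, `c₀² q₀ = 2`, `c₁² q₁ = −2` -/
      have hq₁ : q₁ < 0 := by nlinarith
      have hq₁0 : q₁ ≠ 0 := hq₁.ne
      have hq₀0 : q₀ ≠ 0 := hpos.ne'
      set c₀ : ℝ := Real.sqrt (2 / q₀) with hc₀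
      set c₁ : ℝ := Real.sqrt (2 / (-q₁)) with hc₁
      have hc₀sq : c₀ * c₀ = 2 / q₀ := Real.mul_self_sqrt (div_nonneg zero_le_two hpos.le)
      have hc₁sq : c₁ * c₁ = 2 / (-q₁) := Real.mul_self_sqrt (div_nonneg zero_le_two (by linarith))
      have hc₀pos : 0 < c₀ := Real.sqrt_pos.2 (div_pos two_pos hpos)
      have hc₁pos : 0 < c₁ := Real.sqrt_pos.2 (div_pos two_pos (by linarith))
      have hc₀q : (c₀ : ℂ) * (q₀ : ℂ) * (c₀ : ℂ) = 2 := by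
        have h : c₀ * q₀ * c₀ = 2 := by
          rw [mul_assoc, mul_comm q₀, ← mul_assoc, hc₀sq]; field_simp
        exact_mod_cast h
      have hc₁q : (c₁ : ℂ) * (q₁ : ℂ) * (c₁ : ℂ) = -2 := by
        have h : c₁ * q₁ * c₁ = -2 := by
          rw [mul_assoc, mul_comm q₁, ← mul_assoc, hc₁sq]; field_simp
        exact_mod_cast h
      set W : Matrix (Fin 2) (Fin 2) ℂ := !![(c₀ : ℂ), 0; 0, (c₁ : ℂ)] with hW
      have hWdet : IsUnit W.det := by
        rw [hW, Matrix.det_fin_two]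
        refine isUnit_iff_ne_zero.2 ?_
        simp only [Matrix.of_apply, Matrix.cons_val', Matrix.cons_val_zero, Matrix.cons_val_one, Matrix.cons_val_fin_one,
          Matrix.empty_val', mul_zero, sub_zero]
        exact mul_ne_zero (by exact_mod_cast hc₀pos.ne') (by exact_mod_cast hc₁pos.ne')
      have hVdet : IsUnit (S * W).det := by rw [det_mul]; exact hS.mul hWdet
      have hV : ((S * W).map (starRingEnd ℂ))ᵀ * J * (S * W) = !![2, 0; 0, -2] := by
        rw [hgram W]
        ext i j
        fin_cases i <;> fin_cases j <;>
          simp [hW, Matrix.mul_apply, Fin.sum_univ_two, hQ01, hQ10z, hQ00r, hQ11r, Complex.conj_ofReal]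
        · exact hc₀q
        · exact hc₁q
      have hyV : y * (S * W) = (S * W) * diagonal d := by
        have hcomm : diagonal d * W = W * diagonal d := by
          ext i j
          fin_cases i <;> fin_cases j <;> simp [hW, Matrix.mul_apply, diagonal] <;> ring
        calc y * (S * W) = (y * S) * W := by rw [Matrix.mul_assoc]
          _ = S * (diagonal d * W) := by rw [hyS, Matrix.mul_assoc]
          _ = S * W * diagonal d := by rw [hcomm, Matrix.mul_assoc]
      obtain ⟨g₀, hg₀, hg₀det, hyg₀⟩ := exists_unitary_conj_torusMatrix_of_frame hV hVdet hyV
      exact ⟨g₀, hg₀, hg₀det, Or.inl ⟨d 0, d 1, hd01, hyg₀⟩⟩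
    · /- sub-case `Q₀₀ < 0 < Q₁₁`: frame `V = S W` with the eigenvectors SWAPPED, `W = (0 c₁; c₀ 0)`, `c₀² q₁ = 2`, `c₁² q₀ = −2`; the torus point is `torusMatrix d₁ d₀` -/
      have hq₀0 : q₀ ≠ 0 := fun h => by rw [h, zero_mul] at hneg; exact lt_irrefl _ hneg
      have hq₀neg : q₀ < 0 := lt_of_le_of_ne (not_lt.1 hpos) hq₀0
      have hq₁pos : 0 < q₁ := by nlinarith
      have hq₁0 : q₁ ≠ 0 := hq₁pos.ne'
      set c₀ : ℝ := Real.sqrt (2 / q₁) with hc₀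
      set c₁ : ℝ := Real.sqrt (2 / (-q₀)) with hc₁
      have hc₀sq : c₀ * c₀ = 2 / q₁ := Real.mul_self_sqrt (div_nonneg zero_le_two hq₁pos.le)
      have hc₁sq : c₁ * c₁ = 2 / (-q₀) := Real.mul_self_sqrt (div_nonneg zero_le_two (by linarith))
      have hc₀pos : 0 < c₀ := Real.sqrt_pos.2 (div_pos two_pos hq₁pos)
      have hc₁pos : 0 < c₁ := Real.sqrt_pos.2 (div_pos two_pos (by linarith))
      have hc₀q : (c₀ : ℂ) * (q₁ : ℂ) * (c₀ : ℂ) = 2 := by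
        have h : c₀ * q₁ * c₀ = 2 := by
          rw [mul_assoc, mul_comm q₁, ← mul_assoc, hc₀sq]; field_simp
        exact_mod_cast h
      have hc₁q : (c₁ : ℂ) * (q₀ : ℂ) * (c₁ : ℂ) = -2 := by
        have h : c₁ * q₀ * c₁ = -2 := by
          rw [mul_assoc, mul_comm q₀, ← mul_assoc, hc₁sq]; field_simp
        exact_mod_cast h
      set W : Matrix (Fin 2) (Fin 2) ℂ := !![0, (c₁ : ℂ); (c₀ : ℂ), 0] with hW
      have hWdet : IsUnit W.det := by
        rw [hW, Matrix.det_fin_two]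
        refine isUnit_iff_ne_zero.2 ?_
        simp only [Matrix.of_apply, Matrix.cons_val', Matrix.cons_val_zero, Matrix.cons_val_one, Matrix.cons_val_fin_one,
          Matrix.empty_val', zero_mul, zero_sub, neg_ne_zero]
        exact mul_ne_zero (by exact_mod_cast hc₁pos.ne') (by exact_mod_cast hc₀pos.ne')
      have hVdet : IsUnit (S * W).det := by rw [det_mul]; exact hS.mul hWdet
      have hV : ((S * W).map (starRingEnd ℂ))ᵀ * J * (S * W) = !![2, 0; 0, -2] := by
        rw [hgram W]
        ext i j
        fin_cases i <;> fin_cases j <;>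
          simp [hW, Matrix.mul_apply, Fin.sum_univ_two, hQ01, hQ10z, hQ00r, hQ11r, Complex.conj_ofReal]
        · exact hc₀q
        · exact hc₁q
      -- the swapped eigenvalues
      have hyV : y * (S * W) = (S * W) * diagonal ![d 1, d 0] := by
        have hcomm : diagonal d * W = W * diagonal ![d 1, d 0] := by
          ext i j
          fin_cases i <;> fin_cases j <;> simp [hW, Matrix.mul_apply, diagonal] <;> ring
        calc y * (S * W) = (y * S) * W := by rw [Matrix.mul_assoc]
          _ = S * (diagonal d * W) := by rw [hyS, Matrix.mul_assoc]
          _ = S * W * diagonal ![d 1, d 0] := by rw [hcomm, Matrix.mul_assoc]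
      obtain ⟨g₀, hg₀, hg₀det, hyg₀⟩ := exists_unitary_conj_torusMatrix_of_frame hV hVdet hyV
      refine ⟨g₀, hg₀, hg₀det, Or.inl ⟨d 1, d 0, hd01.symm, ?_⟩⟩
      simpa using hyg₀

end Plain

/-! ## §3 The dichotomy in the group `U(Φ₂)(ℂ)` and at the complex places of `H_∞` -/

section Group

/-- A `Φ₂`-unitary invertible matrix as an element of the subgroup `U(Φ₂)(ℂ) ≤ GL₂(ℂ)` (★ `mem_unitaryGroupOfForm_iff`); underlying matrix unchanged. [cite: Rogawski1990, §3.1 p. 19] -/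
theorem exists_mem_unitaryGroupOfForm_coe_eq {g : Matrix (Fin 2) (Fin 2) ℂ}
    (hg : (g.map (starRingEnd ℂ))ᵀ * (Matrix.of fun i j : Fin 2 => if i.val + j.val + 1 = 2 then (1 : ℂ) else 0) * g =
      (Matrix.of fun i j : Fin 2 => if i.val + j.val + 1 = 2 then (1 : ℂ) else 0))
    (hdet : IsUnit g.det) :
    ∃ u : ↥(unitaryGroupOfForm (starRingEnd ℂ) (Matrix.of fun i j : Fin 2 => if i.val + j.val + 1 = 2 then (1 : ℂ) else 0)),
      ((u : GL (Fin 2) ℂ) : Matrix (Fin 2) (Fin 2) ℂ) = g := by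
  refine ⟨⟨Matrix.nonsingInvUnit g hdet, ?_⟩, rfl⟩
  rw [mem_unitaryGroupOfForm_iff]
  exact hg

/-- **THE REGULAR DICHOTOMY IN THE GROUP `U(Φ₂)(ℂ)`** (carrier `↥(unitaryGroupOfForm (starRingEnd ℂ) Φ₂ℂ)`, LH2-p04's letters): a regular semisimple `g` is conjugate IN
`U(Φ₂)(ℂ)` to a regular point of the compact torus (`g = g₀ · torusMatrix l₁ l₂ · g₀⁻¹` as matrices, `l₁ ≠ l₂`) or of the split torus (`g = h δ h⁻¹` in the group with
`δ = diag(λ₁, λ₂)`, `λ₁ ≠ λ₂` — the data `(h, δ, hγ, hne, hconj)` of ★ `exists_measure_descConj_hs_add_one_le_rpow_of_diag_haar`). [cite: Rogawski1990, §3.6 p. 31; §3.1 p. 19]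
[cite: Knapp1986, Ch. V §3] -/
theorem exists_conj_torusMatrix_or_diagonal_of_mem_unitaryGroupOfForm
    (g : ↥(unitaryGroupOfForm (starRingEnd ℂ) (Matrix.of fun i j : Fin 2 => if i.val + j.val + 1 = 2 then (1 : ℂ) else 0)))
    (hsep : (((g : GL (Fin 2) ℂ)) : Matrix (Fin 2) (Fin 2) ℂ).charpoly.Separable) :
    (∃ (g₀ : ↥(unitaryGroupOfForm (starRingEnd ℂ) (Matrix.of fun i j : Fin 2 => if i.val + j.val + 1 = 2 then (1 : ℂ) else 0))) (l₁ l₂ : ℂ),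
        l₁ ≠ l₂ ∧ (((g : GL (Fin 2) ℂ)) : Matrix (Fin 2) (Fin 2) ℂ) =
          ((g₀ : GL (Fin 2) ℂ) : Matrix (Fin 2) (Fin 2) ℂ) * torusMatrix l₁ l₂ * (((g₀ : GL (Fin 2) ℂ)) : Matrix (Fin 2) (Fin 2) ℂ)⁻¹) ∨
      (∃ (h δ : ↥(unitaryGroupOfForm (starRingEnd ℂ) (Matrix.of fun i j : Fin 2 => if i.val + j.val + 1 = 2 then (1 : ℂ) else 0))) (l₁ l₂ : ℂ),
        l₁ ≠ l₂ ∧ (((δ : GL (Fin 2) ℂ)) : Matrix (Fin 2) (Fin 2) ℂ) = !![l₁, 0; 0, l₂] ∧ g = h * δ * h⁻¹) := by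
  have hy : ((((g : GL (Fin 2) ℂ)) : Matrix (Fin 2) (Fin 2) ℂ).map (starRingEnd ℂ))ᵀ *
      (Matrix.of fun i j : Fin 2 => if i.val + j.val + 1 = 2 then (1 : ℂ) else 0) * (((g : GL (Fin 2) ℂ)) : Matrix (Fin 2) (Fin 2) ℂ) =
        (Matrix.of fun i j : Fin 2 => if i.val + j.val + 1 = 2 then (1 : ℂ) else 0) := mem_unitaryGroupOfForm_iff.1 g.2
  obtain ⟨g₀, hg₀, hg₀det, hcases⟩ := exists_unitary_conj_torusMatrix_or_diagonal hy hsep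
  obtain ⟨u, hu⟩ := exists_mem_unitaryGroupOfForm_coe_eq hg₀ hg₀det
  rcases hcases with ⟨l₁, l₂, hne, hyl⟩ | ⟨l₁, l₂, hne, hll, hyl⟩
  · exact Or.inl ⟨u, l₁, l₂, hne, by rw [hu]; exact hyl⟩
  · -- the split representative `δ = diag(l₁, l₂)` is itself `Φ₂`-unitary (`l̄₁ l₂ = 1`)
    have hl₁ : l₁ ≠ 0 := fun h0 => by rw [h0, map_zero, zero_mul] at hll; exact zero_ne_one hll
    have hl₂ : l₂ ≠ 0 := fun h0 => by rw [h0, mul_zero] at hll; exact zero_ne_one hll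
    have hll' : starRingEnd ℂ l₂ * l₁ = 1 := by
      have h := congrArg (starRingEnd ℂ) hll
      rwa [map_mul, Complex.conj_conj, map_one, mul_comm] at h
    have hδu : ((!![l₁, 0; 0, l₂] : Matrix (Fin 2) (Fin 2) ℂ).map (starRingEnd ℂ))ᵀ *
        (Matrix.of fun i j : Fin 2 => if i.val + j.val + 1 = 2 then (1 : ℂ) else 0) * !![l₁, 0; 0, l₂] =
          (Matrix.of fun i j : Fin 2 => if i.val + j.val + 1 = 2 then (1 : ℂ) else 0) := by
      ext i j
      fin_cases i <;> fin_cases j <;> simp [Matrix.mul_apply, Fin.sum_univ_two, Matrix.of_apply, hll, hll']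
    have hδdet : IsUnit ((!![l₁, 0; 0, l₂] : Matrix (Fin 2) (Fin 2) ℂ)).det := by
      rw [Matrix.det_fin_two]
      refine isUnit_iff_ne_zero.2 ?_
      simp [hl₁, hl₂]
    obtain ⟨δ, hδ⟩ := exists_mem_unitaryGroupOfForm_coe_eq hδu hδdet
    refine Or.inr ⟨u, δ, l₁, l₂, hne, hδ, ?_⟩
    -- `g = u δ u⁻¹` in the group: compare matrices
    apply Subtype.ext
    apply Units.ext
    rw [Subgroup.coe_mul, Subgroup.coe_mul, Subgroup.coe_inv, Units.val_mul, Units.val_mul, Matrix.coe_units_inv, hu, hδ]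
    exact hyl

variable (L : Type) [Field L] [NumberField L] [IsCMField L]

omit [NumberField L] [IsCMField L] in
/-- **THE REGULAR DICHOTOMY AT A COMPLEX PLACE OF `H_∞`** (carrier `↥(archLocal L 2 Φ₂ w) = U(Φ₂)_w`, LH3's letters): a regular semisimple `γ_w ∈ U(Φ₂)_w` is EITHER
`U(Φ₂)_w`-conjugate to a regular point of the compact torus — `γ_w = g₀ · torusMatrix l₁ l₂ · g₀⁻¹`, `g₀ ∈ U(Φ₂)_w`, `l₁ ≠ l₂`: the `hell w` binder of ★
`haar_setOf_archHSGL_conj_le_of_elliptic_linear` ∕ ★ `isCompact_centralizer_archLocal_of_conj_torusMatrix` VERBATIM — OR conjugate in `U(Φ₂)_w` to a regular DIAGONAL element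
`δ`, `γ_w = h δ h⁻¹`, `δ = diag(λ₁, λ₂)`, `λ₁ ≠ λ₂` (the split-place data of ★ `exists_measure_descConj_hs_add_one_le_rpow_of_diag_haar` through the identification
`archLocal L 2 Φ₂ w = unitaryGroupOfForm (starRingEnd ℂ) Φ₂ℂ`, ★ `antidiagOne_map`). [cite: Rogawski1990, §3.6 p. 31; §4.3 p. 42; §14.3 p. 234] [cite: Knapp1986, Ch. V §3] -/
theorem exists_conj_torusMatrix_or_diagonal_archLocal (w : {w : InfinitePlace L // w.IsComplex})
    (γ : ↥(archLocal L 2 (Matrix.of fun i j : Fin 2 => if i.val + j.val + 1 = 2 then (1 : L) else 0) w))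
    (hsep : (((γ : GL (Fin 2) ℂ)) : Matrix (Fin 2) (Fin 2) ℂ).charpoly.Separable) :
    (∃ (g₀ : ↥(archLocal L 2 (Matrix.of fun i j : Fin 2 => if i.val + j.val + 1 = 2 then (1 : L) else 0) w)) (l₁ l₂ : ℂ), l₁ ≠ l₂ ∧
        (((γ : GL (Fin 2) ℂ)) : Matrix (Fin 2) (Fin 2) ℂ) =
          ((g₀ : GL (Fin 2) ℂ) : Matrix (Fin 2) (Fin 2) ℂ) * torusMatrix l₁ l₂ * (((g₀ : GL (Fin 2) ℂ)) : Matrix (Fin 2) (Fin 2) ℂ)⁻¹) ∨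
      (∃ (h δ : ↥(archLocal L 2 (Matrix.of fun i j : Fin 2 => if i.val + j.val + 1 = 2 then (1 : L) else 0) w)) (l₁ l₂ : ℂ),
        l₁ ≠ l₂ ∧ (((δ : GL (Fin 2) ℂ)) : Matrix (Fin 2) (Fin 2) ℂ) = !![l₁, 0; 0, l₂] ∧ γ = h * δ * h⁻¹) := by
  -- the two subgroups of `GL₂(ℂ)` coincide
  have heq : archLocal L 2 (Matrix.of fun i j : Fin 2 => if i.val + j.val + 1 = 2 then (1 : L) else 0) w =
      unitaryGroupOfForm (starRingEnd ℂ) (Matrix.of fun i j : Fin 2 => if i.val + j.val + 1 = 2 then (1 : ℂ) else 0) := by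
    unfold archLocal
    rw [antidiagOne_map]
  rcases exists_conj_torusMatrix_or_diagonal_of_mem_unitaryGroupOfForm ⟨(γ : GL (Fin 2) ℂ), heq ▸ γ.2⟩ hsep with
    ⟨g₀, l₁, l₂, hne, hγ⟩ | ⟨h, δ, l₁, l₂, hne, hδ, hconj⟩
  · exact Or.inl ⟨⟨(g₀ : GL (Fin 2) ℂ), heq.symm ▸ g₀.2⟩, l₁, l₂, hne, hγ⟩
  · refine Or.inr ⟨⟨(h : GL (Fin 2) ℂ), heq.symm ▸ h.2⟩, ⟨(δ : GL (Fin 2) ℂ), heq.symm ▸ δ.2⟩, l₁, l₂, hne, hδ, ?_⟩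
    apply Subtype.ext
    have h1 := congrArg (fun u : ↥(unitaryGroupOfForm (starRingEnd ℂ) (Matrix.of fun i j : Fin 2 => if i.val + j.val + 1 = 2 then (1 : ℂ) else 0)) =>
      (u : GL (Fin 2) ℂ)) hconj
    simpa only [Subgroup.coe_mul, Subgroup.coe_inv] using h1

/-- **`G`-regularity of `γ ∈ H_∞` gives the separability hypothesis at every complex place**: `ι_∞(γ)` regular semisimple in `GL₃(L ⊗ ℝ)` (★ `IsArchGRegular`) ⇒ the `2`-block
has separable characteristic polynomial over `L ⊗ ℝ` (★ `charpoly_endoGL`: `charpoly ι(γ₂, γ₁) = charpoly γ₂ · charpoly γ₁`) ⇒ so does its image `γ_w` at each complex place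
(`Polynomial.Separable.map`, ★ `coe_archPiEquivCM_apply`). [cite: Rogawski1990, §4.3 p. 42; §14.3 p. 234] -/
theorem charpoly_archPiEquivCM_separable_of_isArchGRegular
    (γ : ↥(UnitaryGroup.arch (↥(maximalRealSubfield L)) L (IsCMField.complexConj L) 2 (Matrix.of fun i j : Fin 2 => if i.val + j.val + 1 = 2 then (1 : L) else 0)) ×
      ↥(UnitaryGroup.arch (↥(maximalRealSubfield L)) L (IsCMField.complexConj L) 1 (Matrix.of fun i j : Fin 1 => if i.val + j.val + 1 = 1 then (1 : L) else 0)))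
    (hreg : IsArchGRegular L γ) (w : {w : InfinitePlace L // w.IsComplex}) :
    (((archPiEquivCM 2 L (Matrix.of fun i j : Fin 2 => if i.val + j.val + 1 = 2 then (1 : L) else 0) γ.1 w :
        ↥(archLocal L 2 (Matrix.of fun i j : Fin 2 => if i.val + j.val + 1 = 2 then (1 : L) else 0) w)) : GL (Fin 2) ℂ) :
        Matrix (Fin 2) (Fin 2) ℂ).charpoly.Separable := by
  -- the 2-block is regular semisimple over `L ⊗ ℝ`
  have hreg2 : (((γ.1.val : GL (Fin 2) (mixedSpace L))) : Matrix (Fin 2) (Fin 2) (mixedSpace L)).charpoly.Separable := by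
    have h : IsRegularElt ((endoEmbArch L γ).val : GL (Fin 3) (mixedSpace L)) := hreg
    rw [isRegularElt_iff, coe_endoEmbArch, charpoly_endoGL] at h
    exact h.of_mul_left
  have hval : (((archPiEquivCM 2 L (Matrix.of fun i j : Fin 2 => if i.val + j.val + 1 = 2 then (1 : L) else 0) γ.1 w :
        ↥(archLocal L 2 (Matrix.of fun i j : Fin 2 => if i.val + j.val + 1 = 2 then (1 : L) else 0) w)) : GL (Fin 2) ℂ) : Matrix (Fin 2) (Fin 2) ℂ) =
      (((γ.1.val : GL (Fin 2) (mixedSpace L))) : Matrix (Fin 2) (Fin 2) (mixedSpace L)).map (evalC L w) := by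
    rw [coe_archPiEquivCM_apply]
    rfl
  rw [hval, Matrix.charpoly_map]
  exact hreg2.map

end Group

end Literature.NumberTheory.Rogawski1990

end
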